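/-
Copyright (c) 2026 the pub-hodgecm-mathlib formalisation cell (harness21).  Prover seat hodgecm-mathlib-K2E3-p23 (g6), HCML Track B «K2-LIT» ∕ h413
(`stmt-HodgeConjecture-24833`), line `K2_E3_EllipticInputs`, road «GL₂-sc» (road owner K2E5-p17 (g5), dealer K2E3-plan (g4)), NON-ELLIPTIC half, brick 2N-4,
FILE 1 OF 3: the `Fin 2` reading of ★ (C-shell B) FILE 1 `K2E3GL3SupercuspOrbitalSliceCuspidal` (K2E3-p21 (g5)) + the `G' = GL₂(F) ⧸ Λ·1` pull-back reading of ★ B4-J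
`K2E3GL3SupercuspidalJacquetVanishing` — the cusp binder `hcuspB` of ★ T20₂ for the slice `z ↦ B u' (ρ(π_Λ(z γ z⁻¹)) u)` of a supercuspidal coefficient.  2026-09-04.
-/
import Summits.HodgeConjecture.HodgeConjecture.Theorems.K2E3GL2CuspFormCancellation                -- ★ T20₂ (this seat): the head; brings ★ T20-GL₃ generic §1 (`coe_permGL_inv_mul_mul_permGL`), `permGL`, ★ (B-Iw) F1 `unipotentRadicalGL_eq_of_forall_le_iff`
import Summits.HodgeConjecture.HodgeConjecture.Theorems.K2E3GL3SupercuspOrbitalSliceCuspidal          -- ★ (C-shell B) F1 (K2E3-p21 g5): GENERIC §1 `integral_comp_coe_eq_zero_of_eq`; brings ★ B4-J FILES 1–4 (generic `GL_n` Jacquet vanishing, `isSmooth_comp_mk'_iff`, `isSupercuspidal_comp_mk'`), ★ B4-E1 generic `forall_integral_unipotent_conj_eq_zero_of_cuspForm`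
import Summits.HodgeConjecture.HodgeConjecture.Theorems.K2E3GL2ModCocompactFrame                     -- ★ (2F-b″) p858833 (K2E5-p17 g5): `center_quotScalar_eq` at `Fin 2`
import Literature.NumberTheory.Automorphic.GL3UpperUnipotentTwistedConjugation                        -- ★ `boxAd_glDiagonal` (generic `n`)
import HarnessLib

/-!
# Road «GL₂-sc», non-elliptic half, brick 2N-4 (file 1 of 3) — the slice of a supercuspidal coefficient of `G' = GL₂(F) ⧸ Λ·1` through a split regular `γ` is a cusp form

Cell `pub/hodgecm-mathlib` (D-0151), Track B «K2-LIT», crux H413 = `stmt-HodgeConjecture-24833`, route of record `HCCMUnconditional`.  Lane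
`--supports stmt-HodgeConjecture-24833 --as helper`; THEOREMS ONLY (no `def`, no `instance`, no `notation`, no named-fact hypothesis, no `sorry`); count-neutral.
CONSUMER: ★ T20₂ `K2E3GL2CuspFormCancellation.cuspForm_cancellation_GL2_split`, whose binders `hf` and `hcuspB` this file DISCHARGES for the slice of a supercuspidal
coefficient of `G_Λ = GL₂(F) ⧸ Λ·1` (any `Λ₀`, `[CharZero F]`) through a REGULAR DIAGONAL `γ` (`(γ : Matrix) = diagonal d`, `d` injective); `hsupp` (★ T18₂) and the `hcanc`
are FILE 3.  [HarishChandra1970, Part I §3 p. 9; Part VII §2 Thm 20, §8 Lemma 57]; [Casselman1995, Thm. 5.3.1]; [Rogawski1990, §4.13 p. 70].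
For `w = permGL σ` and `u ∈ N₂`: `f(x·(w u w⁻¹)) = θ̃((x w)·(u γ^w u⁻¹)·(x w)⁻¹)` with `γ^w = w⁻¹ γ w = glDiagonal (d ∘ σ⁻¹)` again regular diagonal; the twisted commutator
`u ↦ u γ^w u⁻¹ (γ^w)⁻¹` is a homeomorphism of `N₂` scaling Haar by `|det(1 − K_{γ^w})|⁻¹ = |1 − d_{σ⁻¹0}∕d_{σ⁻¹1}|⁻¹` (★ generic B4-E1 §1), so the integral is a multiple of the
two-sided cusp integral `∫_{N₂} θ̃(a u b) du = 0` of the supercuspidal pull-back `ρ ∘ π_Λ` (★ B4-J generic `GL_n` heads); the `Fin 2`-labelled carrier of T20₂ is reached from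
the `Bool`-labelled one by the equality transport ★ `unipotentRadicalGL_eq_of_forall_le_iff`.
* §1 `det_one_sub_boxAd_glDiagonal_fin_two` (`det(1 − K_t) = 1 − t₀∕t₁` for the Borel of `GL₂`).
* §2 **`isSupercuspidal_comp_mk'_quotScalar`** (`ρ ∘ π_Λ` supercuspidal on `GL₂(F)`; ★ generic `isSupercuspidal_comp_mk'` with ★ (2F-b″) `center_quotScalar_eq`),
  **`integral_sesqForm_apply_translate_unipotentRadicalGL_comp_mk_eq_zero'`** (`∫_{U_c} B u' (ρ(π_Λ(x u y)) u) dν = 0`, any proper monotone labels `c : Fin 2 → α`).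
* §3 `permGL_inv_mul_mul_permGL_eq_glDiagonal`, `continuous_slice` (`hf`), `slice_mul_conj_eq`, **`slice_hcuspB`** — T20₂'s binder `hcuspB` VERBATIM.
HONEST LABEL: HC_CM is proved only modulo the 7 printed citations (2 remaining named inputs: hLiu418 = `stmt-HodgeConjecture-24832`, h413 = `stmt-HodgeConjecture-24833`)
until rung 0 closes; count-neutral helper.

## References
* [HarishChandra1970] Harish-Chandra (notes by G. van Dijk), *Harmonic Analysis on Reductive p-adic Groups*, LNM 162 (1970), Part I §3 p. 9; Part VII §2, §8.
* [Casselman1995] W. Casselman, *Introduction to the theory of admissible representations of `p`-adic reductive groups* (1995 notes), Thm. 5.3.1, Prop. 1.4.4.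
* [Rogawski1990] J. D. Rogawski, *Automorphic Representations of Unitary Groups in Three Variables*, Ann. of Math. Stud. 123 (1990), §4.13 p. 70.
-/

set_option autoImplicit false
-- the mandated namespace repeats the single-problem summit's segment (`HodgeConjecture.HodgeConjecture`)
set_option linter.dupNamespace false

noncomputable section

open MeasureTheory MeasureTheory.Measure Set Filter Topology
open scoped MatrixGroups Pointwise WithZero
open Literature.NumberTheory.Automorphic Literature.NumberTheory.GaloisRepresentations Literature.NumberTheory.GaloisRepresentations.IsNonarchimedeanLocalField
open Summit.HodgeConjecture.HodgeConjecture.Cruxes.H413.K2E3GL3SupercuspidalJacquetVanishing (isSmooth_comp_mk'_iff isSupercuspidal_comp_mk')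
open Summit.HodgeConjecture.HodgeConjecture.Cruxes.H413.K2E3GL3SupercuspidalCuspFormOppositeRadicals (integral_matrixCoeff_sesqForm_translate_unipotentRadicalGL_eq_zero)
open Summit.HodgeConjecture.HodgeConjecture.Cruxes.H413.K2E3GL3SupercuspOrbitalSliceCuspidal (integral_comp_coe_eq_zero_of_eq)
open Summit.HodgeConjecture.HodgeConjecture.Cruxes.H413.K2E3GLnCongruenceIwahoriTriple (unipotentRadicalGL_eq_of_forall_le_iff)
open Summit.HodgeConjecture.HodgeConjecture.Cruxes.H413.K2E3GL3CuspFormCancellation (coe_permGL_inv_mul_mul_permGL)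
open Summit.HodgeConjecture.HodgeConjecture.Cruxes.H413.K2E3GL3CuspFormCancellationMaxParabolic (forall_integral_unipotent_conj_eq_zero_of_cuspForm)

namespace Summit.HodgeConjecture.HodgeConjecture.Cruxes.H413.K2E3GL2SupercuspOrbitalSliceCuspidal

/-! ## §1  `det(1 − K_t) = 1 − t₀∕t₁` for the Borel of `GL₂` -/

section Det

variable {R : Type*} [CommRing R]

/-- **`det(1 − K_t) = 1 − t₀∕t₁`** for `GL₂`, the Borel `P_{![false, true]}` and the diagonal `t = diag(t₀, t₁)` (★ `boxAd_glDiagonal`: `K_t = (t₀∕t₁)`, a `1 × 1` box).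
[cite: Rogawski1990, §4.13, proof of Lemma 4.13.1, p. 70] -/
theorem det_one_sub_boxAd_glDiagonal_fin_two (t : Fin 2 → Rˣ) (hP : glDiagonal 2 R t ∈ standardParabolicGL R ![false, true]) :
    (1 - Matrix.of fun q q' : {i : Fin 2 // ![false, true] i = false} × {j : Fin 2 // ![false, true] j = true} =>
      (((⟨glDiagonal 2 R t, hP⟩ : standardParabolicGL R ![false, true]) : GL (Fin 2) R) : Matrix (Fin 2) (Fin 2) R) q.1 q'.1 *
        ((((⟨glDiagonal 2 R t, hP⟩ : standardParabolicGL R ![false, true])⁻¹ : standardParabolicGL R ![false, true]) : GL (Fin 2) R) : Matrix (Fin 2) (Fin 2) R)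
          q'.2 q.2).det =
      1 - (t 0 : R) * (((t 1)⁻¹ : Rˣ) : R) := by
  rw [boxAd_glDiagonal, ← Matrix.diagonal_one, Matrix.diagonal_sub, Matrix.det_diagonal]
  change ∏ q : {i : Fin 2 // ![false, true] i = false} × {j : Fin 2 // ![false, true] j = true}, ((1 : R) - (t q.1 : R) * (((t q.2)⁻¹ : Rˣ) : R)) = _
  rw [Fintype.prod_prod_type]
  have htrue : ∀ x : Fin 2, x ∈ ({1} : Finset (Fin 2)) ↔ ![false, true] x = true := by decide
  have hfalse : ∀ x : Fin 2, x ∈ ({0} : Finset (Fin 2)) ↔ ![false, true] x = false := by decide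
  have hinner : ∀ a : {i : Fin 2 // ![false, true] i = false},
      ∏ b : {j : Fin 2 // ![false, true] j = true}, ((1 : R) - (t a : R) * (((t b)⁻¹ : Rˣ) : R)) = 1 - (t a : R) * (((t 1)⁻¹ : Rˣ) : R) := by
    intro a
    rw [show (∏ b : {j : Fin 2 // ![false, true] j = true}, ((1 : R) - (t a : R) * (((t b)⁻¹ : Rˣ) : R))) =
        ∏ j ∈ ({1} : Finset (Fin 2)), ((1 : R) - (t a : R) * (((t j)⁻¹ : Rˣ) : R)) from
      (Finset.prod_subtype _ htrue (fun j : Fin 2 => (1 : R) - (t a : R) * (((t j)⁻¹ : Rˣ) : R))).symm, Finset.prod_singleton]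
  simp_rw [hinner]
  rw [show (∏ a : {i : Fin 2 // ![false, true] i = false}, ((1 : R) - (t a : R) * (((t 1)⁻¹ : Rˣ) : R))) =
      ∏ i ∈ ({0} : Finset (Fin 2)), ((1 : R) - (t i : R) * (((t 1)⁻¹ : Rˣ) : R)) from
    (Finset.prod_subtype _ hfalse (fun i : Fin 2 => (1 : R) - (t i : R) * (((t 1)⁻¹ : Rˣ) : R))).symm, Finset.prod_singleton]

end Det

/-! ## §2  The pull-back reading `θ̃ = θ ∘ π_Λ` on `GL₂(F)`: supercuspidality and the cusp property along `U_c` -/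

section PullBack

variable {F : Type*} [Field F] [ValuativeRel F] [TopologicalSpace F] [IsNonarchimedeanLocalField F] [CharZero F] (Λ₀ : Subgroup Fˣ)
  [(Λ₀.map (Matrix.GeneralLinearGroup.scalar (Fin 2))).Normal] {V : Type*} [AddCommGroup V] [Module ℂ V]
  (ρ : Representation ℂ (GL (Fin 2) F ⧸ Λ₀.map (Matrix.GeneralLinearGroup.scalar (Fin 2))) V) {α : Type*} [LinearOrder α] [Fintype α]
  {B : V →ₗ⋆[ℂ] V →ₗ[ℂ] ℂ}

/-- **SUPERCUSPIDAL ON `G_Λ` ⇒ SUPERCUSPIDAL ON `GL₂(F)`**: the pull-back `ρ ∘ π_Λ` of a supercuspidal representation of `G_Λ = GL₂(F) ⧸ Λ·1` is supercuspidal (★ generic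
`isSupercuspidal_comp_mk'` with `Λ·1 ≤ Z` ★ `map_scalar_le_center` and `Z(G_Λ) = π_Λ(Z(GL₂))` ★ (2F-b″) `center_quotScalar_eq`, characteristic `0`).
[cite: HarishChandra1970, Part I §3 p. 9, Part VII §3 p. 70] -/
theorem isSupercuspidal_comp_mk'_quotScalar (hsc : ρ.IsSupercuspidal) :
    Representation.IsSupercuspidal (ρ.comp (QuotientGroup.mk' (Λ₀.map (Matrix.GeneralLinearGroup.scalar (Fin 2))))) := by
  haveI := locallyCompactSpace_generalLinearGroup F (n := 2)
  exact isSupercuspidal_comp_mk' _ ρ (K2E3GLnUnipotentModScalars.map_scalar_le_center Λ₀) (K2E3GL2ModCocompactFrame.center_quotScalar_eq Λ₀).le hsc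

/-- **PULL-BACK READING, GENERAL LABELS**: for `ρ` smooth supercuspidal on `G_Λ = GL₂(F) ⧸ Λ·1` (any `Λ₀`), `B` `ρ`-invariant, `c : Fin 2 → α` proper monotone (e.g.
`![false, true] : Fin 2 → Bool`, the Borel), every Haar `ν` on `↥U_c` and all `x y ∈ GL₂(F)`: `∫_{U_c} B u' (ρ(π_Λ(x u y)) u) dν(u) = 0` — ★ generic `GL_n` head for `ρ ∘ π_Λ`.
[cite: HarishChandra1970, Part I §3 p. 9, Part VII §3 p. 70] [cite: Casselman1995, Thm. 5.3.1] -/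
theorem integral_sesqForm_apply_translate_unipotentRadicalGL_comp_mk_eq_zero' (hρ : ρ.IsSmooth) (hsc : ρ.IsSupercuspidal) {c : Fin 2 → α} (hc : IsProperBlocks c)
    (hcm : Monotone c) [MeasurableSpace ↥(unipotentRadicalGL F c)] [BorelSpace ↥(unipotentRadicalGL F c)] (ν : Measure ↥(unipotentRadicalGL F c)) [ν.IsHaarMeasure]
    (hBinv : ∀ (g : GL (Fin 2) F ⧸ Λ₀.map (Matrix.GeneralLinearGroup.scalar (Fin 2))) (v w : V), B (ρ g v) (ρ g w) = B v w)
    (x y : GL (Fin 2) F) (u u' : V) :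
    ∫ uu, B u' (ρ (QuotientGroup.mk (x * (uu : GL (Fin 2) F) * y)) u) ∂ν = 0 :=
  integral_matrixCoeff_sesqForm_translate_unipotentRadicalGL_eq_zero (ρ.comp (QuotientGroup.mk' (Λ₀.map (Matrix.GeneralLinearGroup.scalar (Fin 2))))) ν
    ((isSmooth_comp_mk'_iff _ ρ).2 hρ) (isSupercuspidal_comp_mk'_quotScalar Λ₀ ρ hsc) hc hcm (fun _ v w => hBinv _ v w) x y u u'

end PullBack

/-! ## §3  The slice: the conjugated torus element, continuity, and the cusp binder `hcuspB` of T20₂ -/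

section Slice

variable {F : Type*} [Field F] [ValuativeRel F] [TopologicalSpace F] [IsNonarchimedeanLocalField F] [CharZero F]
  [MeasurableSpace F] [BorelSpace F] [MeasurableSpace (GL (Fin 2) F)] [BorelSpace (GL (Fin 2) F)]
  (Λ₀ : Subgroup Fˣ) [(Λ₀.map (Matrix.GeneralLinearGroup.scalar (Fin 2))).Normal]
  {V : Type*} [AddCommGroup V] [Module ℂ V] (ρ : Representation ℂ (GL (Fin 2) F ⧸ Λ₀.map (Matrix.GeneralLinearGroup.scalar (Fin 2))) V)
  {B : V →ₗ⋆[ℂ] V →ₗ[ℂ] ℂ}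

omit [ValuativeRel F] [TopologicalSpace F] [IsNonarchimedeanLocalField F] [CharZero F] [MeasurableSpace F] [BorelSpace F]
  [MeasurableSpace (GL (Fin 2) F)] [BorelSpace (GL (Fin 2) F)] in
/-- **`w⁻¹ γ w` is the `glDiagonal` of the permuted units** (`w = permGL σ`, `(γ : Matrix) = diagonal d`, `d i ≠ 0`). [cite: HarishChandra1970, Part VII §8 p. 80] -/
theorem permGL_inv_mul_mul_permGL_eq_glDiagonal (σ : Equiv.Perm (Fin 2)) {γ : GL (Fin 2) F} {d : Fin 2 → F} (hγ : (γ : Matrix (Fin 2) (Fin 2) F) = Matrix.diagonal d)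
    (hd0 : ∀ i, d i ≠ 0) :
    (permGL σ)⁻¹ * γ * permGL σ = glDiagonal 2 F (fun i => Units.mk0 (d (σ⁻¹ i)) (hd0 _)) := by
  refine Units.ext ?_
  rw [coe_permGL_inv_mul_mul_permGL σ hγ, coe_glDiagonal]
  rfl

omit [CharZero F] [MeasurableSpace F] [BorelSpace F] [MeasurableSpace (GL (Fin 2) F)] [BorelSpace (GL (Fin 2) F)] in
/-- **(hf) The slice `z ↦ B u' (ρ(π_Λ(z γ z⁻¹)) u)` is continuous** for `ρ` smooth. [cite: HarishChandra1970, Part I §3 p. 9] -/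
theorem continuous_slice (hρ : ρ.IsSmooth) (γ : GL (Fin 2) F) (u u' : V) :
    Continuous fun z : GL (Fin 2) F => B u' (ρ (QuotientGroup.mk (z * γ * z⁻¹) : GL (Fin 2) F ⧸ Λ₀.map (Matrix.GeneralLinearGroup.scalar (Fin 2))) u) :=
  ((Representation.IsSmooth.isLocallyConstant_apply ρ hρ u).comp fun w : V => B u' w).continuous.comp
    (QuotientGroup.continuous_mk.comp ((continuous_id.mul continuous_const).mul continuous_id.inv))

omit [ValuativeRel F] [TopologicalSpace F] [IsNonarchimedeanLocalField F] [CharZero F] [MeasurableSpace F] [BorelSpace F]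
  [MeasurableSpace (GL (Fin 2) F)] [BorelSpace (GL (Fin 2) F)] in
/-- The slice at `x·(w u w⁻¹)` is the conjugation coefficient at `(x w)·(u γ^w u⁻¹)·(x w)⁻¹`, `γ^w = w⁻¹ γ w`. [folklore] -/
theorem slice_mul_conj_eq (γ x w u : GL (Fin 2) F) (v v' : V) :
    B v' (ρ (QuotientGroup.mk ((x * (w * u * w⁻¹)) * γ * (x * (w * u * w⁻¹))⁻¹) : GL (Fin 2) F ⧸ Λ₀.map (Matrix.GeneralLinearGroup.scalar (Fin 2))) v) =
      B v' (ρ (QuotientGroup.mk ((x * w) * (u * (w⁻¹ * γ * w) * u⁻¹) * (x * w)⁻¹) : GL (Fin 2) F ⧸ Λ₀.map (Matrix.GeneralLinearGroup.scalar (Fin 2))) v) := by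
  congr 4
  group

variable (hρ : ρ.IsSmooth) (hsc : ρ.IsSupercuspidal) (hBinv : ∀ (g : GL (Fin 2) F ⧸ Λ₀.map (Matrix.GeneralLinearGroup.scalar (Fin 2))) (v w : V), B (ρ g v) (ρ g w) = B v w)
  {γ : GL (Fin 2) F} {d : Fin 2 → F} (hγ : (γ : Matrix (Fin 2) (Fin 2) F) = Matrix.diagonal d) (hd : Function.Injective d) (u u' : V)

include hρ hsc hBinv hγ hd in
/-- **(hcuspB) The slice is a cusp form along `w N₂ w⁻¹`, both chambers** — ★ T20₂'s binder `hcuspB` VERBATIM: for every `σ`, every Haar `ν₀` of `↥(unipotentRadicalGL F id)`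
and every `x`, `∫ f(x · (permGL σ · u · (permGL σ)⁻¹)) dν₀(u) = 0`.  The twisted-commutator substitution (★ generic B4-E1 §1) at the point `x·w` for the regular diagonal
`w⁻¹γw`, fed by the two-sided cusp property of `θ̃` along the Borel radical (§2, `Bool` labels `![false,true]`), then the equality transport `Bool ↔ Fin 2` labels.
[cite: HarishChandra1970, Part VII §2 Thm 20, §8 Lemma 57] [cite: Casselman1995, Thm. 5.3.1] [cite: Rogawski1990, §4.13 p. 70] -/
theorem slice_hcuspB (σ : Equiv.Perm (Fin 2)) (ν₀ : Measure ↥(unipotentRadicalGL F (id : Fin 2 → Fin 2))) [ν₀.IsHaarMeasure] (x : GL (Fin 2) F) :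
    ∫ n, (fun z : GL (Fin 2) F => B u' (ρ (QuotientGroup.mk (z * γ * z⁻¹) : GL (Fin 2) F ⧸ Λ₀.map (Matrix.GeneralLinearGroup.scalar (Fin 2))) u))
      (x * (permGL σ * (n : GL (Fin 2) F) * (permGL σ)⁻¹)) ∂ν₀ = 0 := by
  haveI : T2Space F := (isLocalField F).toT2Space
  have hd0 : ∀ i, d i ≠ 0 := fun i h0 => by
    have hdet : (γ : Matrix (Fin 2) (Fin 2) F).det ≠ 0 := ((Matrix.isUnit_iff_isUnit_det _).1 (Units.isUnit γ)).ne_zero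
    rw [hγ, Matrix.det_diagonal] at hdet
    exact hdet (Finset.prod_eq_zero (Finset.mem_univ i) h0)
  have h01 : ((Units.mk0 (d (σ⁻¹ 0)) (hd0 _) : Fˣ) : F) ≠ (Units.mk0 (d (σ⁻¹ 1)) (hd0 _) : Fˣ) := fun h => by
    have := hd (by simpa using h); exact absurd (σ⁻¹.injective this) (by decide)
  -- the equality of the `Bool`- and `Fin 2`-labelled Borel radicals
  have hEq : unipotentRadicalGL F (![false, true] : Fin 2 → Bool) = unipotentRadicalGL F (id : Fin 2 → Fin 2) :=
    unipotentRadicalGL_eq_of_forall_le_iff fun i j => by fin_cases i <;> fin_cases j <;> decide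
  borelize ↥(unipotentRadicalGL F (![false, true] : Fin 2 → Bool))
  refine integral_comp_coe_eq_zero_of_eq hEq
    (fun g : GL (Fin 2) F => B u' (ρ (QuotientGroup.mk ((x * (permGL σ * g * (permGL σ)⁻¹)) * γ * (x * (permGL σ * g * (permGL σ)⁻¹))⁻¹) :
      GL (Fin 2) F ⧸ Λ₀.map (Matrix.GeneralLinearGroup.scalar (Fin 2))) u)) (fun ν₁ hν₁ => ?_) ν₀
  haveI := hν₁
  -- the two-sided cusp property of `θ̃` along the Borel radical
  have hcusp : ∀ a b : GL (Fin 2) F, ∫ uu : ↥(unipotentRadicalGL F (![false, true] : Fin 2 → Bool)),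
      B u' (ρ (QuotientGroup.mk (a * (uu : GL (Fin 2) F) * b) : GL (Fin 2) F ⧸ Λ₀.map (Matrix.GeneralLinearGroup.scalar (Fin 2))) u) ∂ν₁ = 0 :=
    fun a b => integral_sesqForm_apply_translate_unipotentRadicalGL_comp_mk_eq_zero' Λ₀ ρ hρ hsc
      (c := (![false, true] : Fin 2 → Bool)) ⟨fun t => by rcases Bool.eq_false_or_eq_true t with rfl | rfl <;> [exact ⟨1, rfl⟩; exact ⟨0, rfl⟩], inferInstance⟩
      (by decide) ν₁ hBinv a b u u'
  -- the regular diagonal `γ^w` as an element of the Borel, `det(1 − K) = 1 − d_{σ⁻¹0}/d_{σ⁻¹1} ≠ 0`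
  have hP : glDiagonal 2 F (fun i => Units.mk0 (d (σ⁻¹ i)) (hd0 _)) ∈ standardParabolicGL F (![false, true] : Fin 2 → Bool) := by
    rw [mem_standardParabolicGL_iff, coe_glDiagonal]; exact Matrix.blockTriangular_diagonal _
  have hK : (1 - Matrix.of fun q q' : {i : Fin 2 // ![false, true] i = false} × {j : Fin 2 // ![false, true] j = true} =>
      (((⟨glDiagonal 2 F (fun i => Units.mk0 (d (σ⁻¹ i)) (hd0 _)), hP⟩ : standardParabolicGL F ![false, true]) : GL (Fin 2) F) : Matrix (Fin 2) (Fin 2) F) q.1 q'.1 *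
        ((((⟨glDiagonal 2 F (fun i => Units.mk0 (d (σ⁻¹ i)) (hd0 _)), hP⟩ : standardParabolicGL F ![false, true])⁻¹ : standardParabolicGL F ![false, true]) : GL (Fin 2) F) :
          Matrix (Fin 2) (Fin 2) F) q'.2 q.2).det ≠ 0 := by
    rw [det_one_sub_boxAd_glDiagonal_fin_two]
    refine sub_ne_zero.2 fun h => h01 ?_
    symm
    calc ((Units.mk0 (d (σ⁻¹ 1)) (hd0 _) : Fˣ) : F) = 1 * ((Units.mk0 (d (σ⁻¹ 1)) (hd0 _) : Fˣ) : F) := (one_mul _).symm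
      _ = ((Units.mk0 (d (σ⁻¹ 0)) (hd0 _) : Fˣ) : F) * ((((Units.mk0 (d (σ⁻¹ 1)) (hd0 _))⁻¹ : Fˣ) : F) * ((Units.mk0 (d (σ⁻¹ 1)) (hd0 _) : Fˣ) : F)) := by
          rw [h, mul_assoc]
      _ = ((Units.mk0 (d (σ⁻¹ 0)) (hd0 _) : Fˣ) : F) := by rw [Units.inv_mul, mul_one]
  have hE := forall_integral_unipotent_conj_eq_zero_of_cuspForm ν₁ ⟨glDiagonal 2 F (fun i => Units.mk0 (d (σ⁻¹ i)) (hd0 _)), hP⟩ hK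
    (fun g : GL (Fin 2) F => B u' (ρ (QuotientGroup.mk g : GL (Fin 2) F ⧸ Λ₀.map (Matrix.GeneralLinearGroup.scalar (Fin 2))) u)) hcusp (x * permGL σ) (x * permGL σ)⁻¹
  change ∫ uu : ↥(unipotentRadicalGL F (![false, true] : Fin 2 → Bool)),
      B u' (ρ (QuotientGroup.mk (x * permGL σ * ((uu : GL (Fin 2) F) * glDiagonal 2 F (fun i => Units.mk0 (d (σ⁻¹ i)) (hd0 _)) * ((uu : GL (Fin 2) F))⁻¹) * (x * permGL σ)⁻¹) :
        GL (Fin 2) F ⧸ Λ₀.map (Matrix.GeneralLinearGroup.scalar (Fin 2))) u) ∂ν₁ = 0 at hE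
  rw [← permGL_inv_mul_mul_permGL_eq_glDiagonal σ hγ hd0] at hE
  simp only [slice_mul_conj_eq]
  exact hE

end Slice

end Summit.HodgeConjecture.HodgeConjecture.Cruxes.H413.K2E3GL2SupercuspOrbitalSliceCuspidal

end
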